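import Summits.MatrixMultiplication.OmegaCensus.STPPClosureFilter
import Summits.MatrixMultiplication.OmegaCensus.STPP222DensityTenAnyGroup

/-!
# ω-census: the symmetric near-period closure contradiction (filter N12, abstract part) in ANY group

HONEST FRAMING (pub-omega census; verbatim): lottery ticket; floor = certified bounds/negative ranges.
Census BOOKKEEPING (seat pub-omega-stpp-1 gen 26, 2026-08-27), family (b2).  Abstract multiplicative combinatorics; the customer is
`STPPClosureFilterAnyGroup.lean` (filter N12 for CKSU Def. 5.1 verbatim in arbitrary finite groups).  Nothing here is progress on `ω`.

## Contents

The multiplicative twin of `STPPClosureFilter.lean` §1 (which is the abelian `IsSTPP` kernel of filter N12), built on the one-sided counts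
`difR X δ = |X ∩ Xδ|`, `difL Y g = |Y ∩ gY|` of `STPPNearPeriodAnyGroup.lean`:
* §1 bookkeeping: `repMul_le_right`, `sum_difL`, `difL_one`, the energy inequalities `card_sub_one_mul_le_of_difR/_difL`
  (`(#D − 1)σ + |S| ≤ |S|²` for any `D ∋ 1` of `σ`-near-periods), the translate lemmas with a general bound `t`
  (`two_mul_add_card_le_card_inter_add`, `le_difR_of_translate_le`, `le_difL_of_translate_le`: `2|S| + |Z| ≤ dif + 2t + |G|`), the left
  closure lemma `difL_mul_pos_of_lt` (right one: `difR_mul_pos_of_lt`), and the mass count `card_mul_card_le_of_subset_mul`;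
* §2 `false_of_closure_hyp_group`: `X, Y, Z ⊆ G` with `|X| = sX`, `|Y| = sY`, `|Z| = sZ`, `Σ_{z∈Z} repMul X Y z ≤ V`, every `z ∈ Z`
  factorised, column counts `#{x : x·y ∈ Z} ≤ ta`, row counts `#{y : x·y ∈ Z} ≤ tc`; `σ = 2sX + sZ − 2ta − n`, `σ' = 2sY + sZ − 2tc − n`.
  If `σ, σ' ≥ 1` and (`2σ > sX` or `2σ' > sY`) then `D := X⁻¹X = YY⁻¹`, `D·D ⊆ D` (pigeonhole), `D` is a SUBGROUP, `e = #D ∣ |G|`,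
  `X ⊆ x₀D`, `Y ⊆ Dy₀`, `XY ⊆ x₀Dy₀ ⊇ Z`, whence the numeric conditions `n12Adm sX sY sZ σ σ' e` and the mass inequality
  `sX·sY ≤ V + (e − sZ)·min(sX,sY)` — the SAME decidable predicate as the abelian file, so the abelian census predicate `N12Dead` is
  valid verbatim in every finite group.  No commutativity, no Kneser.

References: H. Cohn, R. Kleinberg, B. Szegedy, C. Umans, FOCS 2005 (arXiv:math/0511460), Def. 5.1 (the customer); the closure device is
folklore (cf. T. Tao, "An elementary non-commutative Freiman theorem", 2009; Mathlib `Mathlib.Combinatorics.Additive.VerySmallDoubling`).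
-/

open Finset

namespace Summit.MatrixMultiplication.OmegaCensus.CubeNB

variable {G : Type*} [Group G] [DecidableEq G]

/-! ## §1 Bookkeeping: counts, energies, translates with a general bound, left closure, mass -/

/-- `repMul X Y g ≤ #Y` (`x ↦ x⁻¹g` is injective). [folklore] -/
theorem repMul_le_right (X Y : Finset G) (g : G) : repMul X Y g ≤ #Y := by
  rw [repMul, ← card_image_of_injective (X.filter fun x => x⁻¹ * g ∈ Y)
    (fun a b (e : a⁻¹ * g = b⁻¹ * g) => by simpa using e)]
  exact card_le_card fun y hy => by
    obtain ⟨x, hx, rfl⟩ := mem_image.1 hy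
    exact (mem_filter.1 hx).2

/-- `difL Y 1 = #Y`. [folklore] -/
theorem difL_one (Y : Finset G) : difL Y 1 = #Y := by
  simp [difL]

/-- Double counting: `Σ_g difL Y g = #Y²` (every pair `(y, y')` is counted once, at `g = y·y'⁻¹`). [folklore] -/
theorem sum_difL [Fintype G] (Y : Finset G) : ∑ g, difL Y g = #Y * #Y := by
  simp only [difL, card_filter]
  rw [sum_comm]
  have : ∀ y ∈ Y, (∑ g : G, if g⁻¹ * y ∈ Y then 1 else 0) = #Y := by
    intro y _
    rw [← card_filter]
    have : (univ.filter fun g : G => g⁻¹ * y ∈ Y) = Y.image (fun y' => y * y'⁻¹) := by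
      ext g
      simp only [mem_filter, mem_univ, true_and, mem_image]
      constructor
      · intro h; exact ⟨g⁻¹ * y, h, by group⟩
      · rintro ⟨y', hy', rfl⟩; simpa using hy'
    rw [this, card_image_of_injective _ fun a b (e : y * a⁻¹ = y * b⁻¹) => by simpa using e]
  rw [sum_congr rfl this, sum_const, smul_eq_mul]

/-- Energy, right counts: if `1 ∈ D` and every `δ ∈ D` has `difR S δ ≥ σ` then `(#D − 1)·σ + |S| ≤ |S|²`. [folklore] -/
theorem card_sub_one_mul_le_of_difR [Fintype G] {S D : Finset G} (h1 : (1 : G) ∈ D) {σ : ℕ}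
    (hD : ∀ δ ∈ D, σ ≤ difR S δ) : (#D - 1) * σ + #S ≤ #S * #S := by
  have hsplit : ∑ δ ∈ D.erase 1, difR S δ + difR S 1 = ∑ δ ∈ D, difR S δ := sum_erase_add _ _ h1
  have hle : ∑ δ ∈ D, difR S δ ≤ #S * #S := by
    rw [← sum_difR S]
    exact sum_le_sum_of_subset_of_nonneg (subset_univ D) fun _ _ _ => Nat.zero_le _
  have hlow : #(D.erase 1) * σ ≤ ∑ δ ∈ D.erase 1, difR S δ := by
    rw [← smul_eq_mul, ← sum_const]
    exact sum_le_sum fun δ hδ => hD δ (mem_of_mem_erase hδ)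
  rw [difR_one] at hsplit
  rw [card_erase_of_mem h1] at hlow
  omega

/-- Energy, left counts: if `1 ∈ D` and every `g ∈ D` has `difL S g ≥ σ` then `(#D − 1)·σ + |S| ≤ |S|²`. [folklore] -/
theorem card_sub_one_mul_le_of_difL [Fintype G] {S D : Finset G} (h1 : (1 : G) ∈ D) {σ : ℕ}
    (hD : ∀ g ∈ D, σ ≤ difL S g) : (#D - 1) * σ + #S ≤ #S * #S := by
  have hsplit : ∑ g ∈ D.erase 1, difL S g + difL S 1 = ∑ g ∈ D, difL S g := sum_erase_add _ _ h1
  have hle : ∑ g ∈ D, difL S g ≤ #S * #S := by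
    rw [← sum_difL S]
    exact sum_le_sum_of_subset_of_nonneg (subset_univ D) fun _ _ _ => Nat.zero_le _
  have hlow : #(D.erase 1) * σ ≤ ∑ g ∈ D.erase 1, difL S g := by
    rw [← smul_eq_mul, ← sum_const]
    exact sum_le_sum fun g hg => hD g (mem_of_mem_erase hg)
  rw [difL_one] at hsplit
  rw [card_erase_of_mem h1] at hlow
  omega

section Translates

variable [Fintype G] {X Y Z : Finset G} {m t : ℕ}

omit [Group G] in
/-- **Inclusion–exclusion of two translates, general bound.**  If `#S = #S' = m` and each meets `Z` in at most `t` points, then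
`2m + |Z| ≤ #(S ∩ S') + 2t + |G|`. [folklore] -/
theorem two_mul_add_card_le_card_inter_add {S S' : Finset G} (hS : #S = m) (hS' : #S' = m)
    (ht : #(S ∩ Z) ≤ t) (ht' : #(S' ∩ Z) ≤ t) : 2 * m + #Z ≤ #(S ∩ S') + 2 * t + Fintype.card G := by
  have hd : Disjoint (S \ Z ∪ S' \ Z) Z := by
    rw [disjoint_left]
    intro g hg hgZ
    rcases mem_union.1 hg with hg | hg <;> exact (mem_sdiff.1 hg).2 hgZ
  have hUZ : #(S \ Z ∪ S' \ Z) + #Z ≤ Fintype.card G := by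
    rw [← card_union_of_disjoint hd]; exact card_le_univ _
  have hIE := card_union_add_card_inter (S \ Z) (S' \ Z)
  have hsub : #((S \ Z) ∩ (S' \ Z)) ≤ #(S ∩ S') :=
    card_le_card fun g hg => by
      rw [mem_inter] at hg ⊢
      exact ⟨(mem_sdiff.1 hg.1).1, (mem_sdiff.1 hg.2).1⟩
  have h1 := card_sdiff_add_card_inter S Z
  have h1' := card_sdiff_add_card_inter S' Z
  omega

/-- **Right near-periods, general column bound.**  If `#X = m` and every right translate `X·y` (`y ∈ Y`) meets `Z` in at most `t`
points, then for `y, y' ∈ Y`: `2m + |Z| ≤ difR X (y'·y⁻¹) + 2t + |G|`. [folklore] -/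
theorem le_difR_of_translate_le (hX : #X = m) (hcol : ∀ y ∈ Y, #(X.filter fun x => x * y ∈ Z) ≤ t) {y y' : G}
    (hy : y ∈ Y) (hy' : y' ∈ Y) : 2 * m + #Z ≤ difR X (y' * y⁻¹) + 2 * t + Fintype.card G := by
  set S := X.image fun x => x * y with hS
  set S' := X.image fun x => x * y' with hS'
  have hSm : #S = m := by rw [hS, card_image_of_injective _ (mul_left_injective y), hX]
  have hS'm : #S' = m := by rw [hS', card_image_of_injective _ (mul_left_injective y'), hX]
  have hSZ : ∀ {w : G}, w ∈ Y → #(X.image (fun x => x * w) ∩ Z) ≤ t := by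
    intro w hw
    have : X.image (fun x => x * w) ∩ Z = (X.filter fun x => x * w ∈ Z).image (fun x => x * w) := by
      ext g
      simp only [mem_inter, mem_image, mem_filter]
      constructor
      · rintro ⟨⟨x, hx, rfl⟩, hg⟩; exact ⟨x, ⟨hx, hg⟩, rfl⟩
      · rintro ⟨x, ⟨hx, hg⟩, rfl⟩; exact ⟨⟨x, hx, rfl⟩, hg⟩
    rw [this]
    exact card_image_le.trans (hcol w hw)
  have hint : #(S ∩ S') = difR X (y' * y⁻¹) := by
    rw [difR, ← card_image_of_injective (X.filter fun x => x * (y' * y⁻¹)⁻¹ ∈ X) (mul_left_injective y)]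
    congr 1
    ext g
    simp only [mem_inter, mem_image, mem_filter, hS, hS']
    constructor
    · rintro ⟨⟨x, hx, rfl⟩, ⟨x', hx', he⟩⟩
      refine ⟨x, ⟨hx, ?_⟩, rfl⟩
      have e : x * (y' * y⁻¹)⁻¹ = x' := by
        rw [mul_inv_rev, inv_inv, ← mul_assoc, ← he, mul_inv_cancel_right]
      rw [e]; exact hx'
    · rintro ⟨x, ⟨hx, hx'⟩, rfl⟩
      refine ⟨⟨x, hx, rfl⟩, ⟨x * (y' * y⁻¹)⁻¹, hx', ?_⟩⟩
      rw [mul_inv_rev, inv_inv]; group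
  have := two_mul_add_card_le_card_inter_add hSm hS'm (hSZ hy) (hSZ hy')
  omega

/-- **Left near-periods, general row bound.**  If `#Y = m` and every left translate `x·Y` (`x ∈ X`) meets `Z` in at most `t` points,
then for `x, x' ∈ X`: `2m + |Z| ≤ difL Y (x⁻¹·x') + 2t + |G|`. [folklore] -/
theorem le_difL_of_translate_le (hY : #Y = m) (hrow : ∀ x ∈ X, #(Y.filter fun y => x * y ∈ Z) ≤ t) {x x' : G}
    (hx : x ∈ X) (hx' : x' ∈ X) : 2 * m + #Z ≤ difL Y (x⁻¹ * x') + 2 * t + Fintype.card G := by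
  set S := Y.image fun y => x * y with hS
  set S' := Y.image fun y => x' * y with hS'
  have hSm : #S = m := by rw [hS, card_image_of_injective _ (mul_right_injective x), hY]
  have hS'm : #S' = m := by rw [hS', card_image_of_injective _ (mul_right_injective x'), hY]
  have hSZ : ∀ {w : G}, w ∈ X → #(Y.image (fun y => w * y) ∩ Z) ≤ t := by
    intro w hw
    have : Y.image (fun y => w * y) ∩ Z = (Y.filter fun y => w * y ∈ Z).image (fun y => w * y) := by
      ext g
      simp only [mem_inter, mem_image, mem_filter]
      constructor
      · rintro ⟨⟨y, hy, rfl⟩, hg⟩; exact ⟨y, ⟨hy, hg⟩, rfl⟩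
      · rintro ⟨y, ⟨hy, hg⟩, rfl⟩; exact ⟨⟨y, hy, rfl⟩, hg⟩
    rw [this]
    exact card_image_le.trans (hrow w hw)
  have hint : #(S ∩ S') = difL Y (x⁻¹ * x') := by
    rw [difL, ← card_image_of_injective (Y.filter fun y => (x⁻¹ * x')⁻¹ * y ∈ Y) (mul_right_injective x)]
    congr 1
    ext g
    simp only [mem_inter, mem_image, mem_filter, hS, hS']
    constructor
    · rintro ⟨⟨y, hy, rfl⟩, ⟨y', hy', he⟩⟩
      refine ⟨y, ⟨hy, ?_⟩, rfl⟩
      have e : (x⁻¹ * x')⁻¹ * y = y' := by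
        rw [mul_inv_rev, inv_inv, mul_assoc, ← he, inv_mul_cancel_left]
      rw [e]; exact hy'
    · rintro ⟨y, ⟨hy, hy'⟩, rfl⟩
      exact ⟨⟨y, hy, rfl⟩, ⟨(x⁻¹ * x')⁻¹ * y, hy', by group⟩⟩
  have := two_mul_add_card_le_card_inter_add hSm hS'm (hSZ hx) (hSZ hx')
  omega

end Translates

/-- **Left closure by pigeonhole.**  If `#Y = m`, `2·difL Y g₁ > m` and `2·difL Y g₂ > m`, then `g₂·g₁` has a positive left count: some
`y ∈ Y` has `g₁⁻¹y ∈ Y` and `g₂y ∈ Y`, and `g₂y = (g₂g₁)(g₁⁻¹y)`. [folklore] -/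
theorem difL_mul_pos_of_lt {Y : Finset G} {m : ℕ} (hY : #Y = m) {g₁ g₂ : G} (h1 : m < 2 * difL Y g₁)
    (h2 : m < 2 * difL Y g₂) : 0 < difL Y (g₂ * g₁) := by
  set P := Y.filter fun y => g₁⁻¹ * y ∈ Y with hP
  set Q := (Y.filter fun y => g₂⁻¹ * y ∈ Y).image fun y => g₂⁻¹ * y with hQ
  have hPc : difL Y g₁ = #P := rfl
  have hQc : #Q = difL Y g₂ := by
    rw [hQ, card_image_of_injective _ (mul_right_injective g₂⁻¹)]; rfl
  have hQY : Q ⊆ Y := fun y hy => by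
    obtain ⟨y', hy', rfl⟩ := mem_image.1 hy
    exact (mem_filter.1 hy').2
  have hPQ : (P ∩ Q).Nonempty := by
    rw [← card_pos]
    have hu : #(P ∪ Q) ≤ m := hY ▸ card_le_card (union_subset (filter_subset _ _) hQY)
    have := card_union_add_card_inter P Q
    omega
  obtain ⟨y, hy⟩ := hPQ
  rw [mem_inter] at hy
  obtain ⟨hyP, hyQ⟩ := hy
  rw [hP, mem_filter] at hyP
  obtain ⟨y', hy', rfl⟩ := mem_image.1 hyQ
  apply card_pos.2
  refine ⟨y', mem_filter.2 ⟨(mem_filter.1 hy').1, ?_⟩⟩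
  have e : (g₂ * g₁)⁻¹ * y' = g₁⁻¹ * (g₂⁻¹ * y') := by group
  rw [e]; exact hyP.2

/-- **Mass count (multiplicative).**  If all products `x·y` lie in `P ⊇ Z` and `Σ_{z ∈ Z} repMul X Y z ≤ V`, then
`|X||Y| ≤ V + (#P − #Z)·min(|X|,|Y|)`. [folklore] -/
theorem card_mul_card_le_of_subset_mul [Fintype G] {X Y Z P : Finset G} (hXYP : ∀ x ∈ X, ∀ y ∈ Y, x * y ∈ P)
    (hZP : Z ⊆ P) {V : ℕ} (hV : ∑ z ∈ Z, repMul X Y z ≤ V) : #X * #Y ≤ V + (#P - #Z) * min #X #Y := by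
  have htot : ∑ g, repMul X Y g = #X * #Y := sum_repMul X Y
  have hsplit : ∑ g, repMul X Y g = ∑ g ∈ P, repMul X Y g := by
    rw [← sum_subset (subset_univ P)]
    intro g _ hg
    exact repMul_eq_zero_of_not_mem hXYP hg
  have hPZ : ∑ g ∈ P, repMul X Y g = ∑ g ∈ Z, repMul X Y g + ∑ g ∈ P \ Z, repMul X Y g := by
    rw [← sum_sdiff hZP, add_comm]
  have hrest : ∑ g ∈ P \ Z, repMul X Y g ≤ (#P - #Z) * min #X #Y := by
    calc ∑ g ∈ P \ Z, repMul X Y g ≤ ∑ g ∈ P \ Z, min #X #Y :=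
          sum_le_sum fun g _ => le_min (repMul_le_left X Y g) (repMul_le_right X Y g)
      _ = (#P - #Z) * min #X #Y := by rw [sum_const, smul_eq_mul, card_sdiff_of_subset hZP]
  omega

/-! ## §2 The N12 contradiction in any group -/

section Abstract

variable [Fintype G]

/-- **The N12 contradiction, multiplicative form.**  `X, Y, Z ⊆ G` with `|X| = sX`, `|Y| = sY`, `|Z| = sZ`, `Σ_{z∈Z} repMul X Y z ≤ V`,
every `z ∈ Z` factorised, column counts `≤ ta`, row counts `≤ tc`.  If `σ, σ' ≥ 1`, (`2σ > sX` or `2σ' > sY`), and every divisor `e` of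
`|G| = n` passing `n12Adm` violates the mass inequality, contradiction.  (`D = X⁻¹X = YY⁻¹` is a subgroup by the pigeonhole closure; see
the file header.) [folklore] -/
theorem false_of_closure_hyp_group {X Y Z : Finset G} {n sX sY sZ V ta tc : ℕ} (hn : Fintype.card G = n) (hX : #X = sX)
    (hY : #Y = sY) (hZ : #Z = sZ) (hV : ∑ z ∈ Z, repMul X Y z ≤ V) (hZpos : ∀ z ∈ Z, 0 < repMul X Y z)
    (hcol : ∀ y ∈ Y, #(X.filter fun x => x * y ∈ Z) ≤ ta) (hrow : ∀ x ∈ X, #(Y.filter fun y => x * y ∈ Z) ≤ tc)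
    (hσ1 : 2 * ta + n + 1 ≤ 2 * sX + sZ) (hσ'1 : 2 * tc + n + 1 ≤ 2 * sY + sZ)
    (hbig : sX + 1 ≤ 2 * (2 * sX + sZ - (2 * ta + n)) ∨ sY + 1 ≤ 2 * (2 * sY + sZ - (2 * tc + n)))
    (hall : ∀ e : ℕ, e < n + 1 → e ∣ n → 0 < e →
      n12Adm sX sY sZ (2 * sX + sZ - (2 * ta + n)) (2 * sY + sZ - (2 * tc + n)) e = true →
      V + (e - sZ) * min sX sY < sX * sY) : False := by
  obtain ⟨σ, hσ⟩ : ∃ σ, 2 * sX + sZ = σ + (2 * ta + n) := ⟨2 * sX + sZ - (2 * ta + n), by omega⟩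
  obtain ⟨σ', hσ'⟩ : ∃ σ', 2 * sY + sZ = σ' + (2 * tc + n) := ⟨2 * sY + sZ - (2 * tc + n), by omega⟩
  have eσ : 2 * sX + sZ - (2 * ta + n) = σ := by omega
  have eσ' : 2 * sY + sZ - (2 * tc + n) = σ' := by omega
  rw [eσ, eσ'] at hbig
  simp only [eσ, eσ'] at hall
  -- near-periods
  have hNPX : ∀ y ∈ Y, ∀ y' ∈ Y, σ ≤ difR X (y' * y⁻¹) := by
    intro y hy y' hy'
    have := le_difR_of_translate_le hX hcol hy hy'
    rw [hZ, hn] at this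
    omega
  have hNPY : ∀ x ∈ X, ∀ x' ∈ X, σ' ≤ difL Y (x⁻¹ * x') := by
    intro x hx x' hx'
    have := le_difL_of_translate_le hY hrow hx hx'
    rw [hZ, hn] at this
    omega
  have hsZn : sZ ≤ n := by rw [← hZ, ← hn]; exact card_le_univ Z
  have hXne : X.Nonempty := card_pos.1 (by omega)
  have hYne : Y.Nonempty := card_pos.1 (by omega)
  -- `D = X⁻¹X`
  set D := (X ×ˢ X).image (fun p : G × G => p.1⁻¹ * p.2) with hD
  have hmemD : ∀ {δ : G}, δ ∈ D ↔ ∃ x ∈ X, ∃ x' ∈ X, δ = x⁻¹ * x' := by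
    intro δ
    simp only [hD, mem_image, mem_product, Prod.exists]
    constructor
    · rintro ⟨x, x', ⟨hx, hx'⟩, rfl⟩; exact ⟨x, hx, x', hx', rfl⟩
    · rintro ⟨x, hx, x', hx', rfl⟩; exact ⟨x, x', ⟨hx, hx'⟩, rfl⟩
  -- `YY⁻¹ ⊆ D` (σ ≥ 1) and `D ⊆ YY⁻¹` (σ' ≥ 1), in the pointwise forms needed below
  have hYYD : ∀ y ∈ Y, ∀ y' ∈ Y, y' * y⁻¹ ∈ D := by
    intro y hy y' hy'
    obtain ⟨x, hx, x', hx', he⟩ := exists_eq_inv_mul_of_difR_pos (X := X) (δ := y' * y⁻¹)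
      (by have := hNPX y hy y' hy'; omega)
    exact hmemD.2 ⟨x', hx', x, hx, he⟩
  have hDYY : ∀ δ ∈ D, ∃ y ∈ Y, ∃ y' ∈ Y, δ = y * y'⁻¹ := by
    intro δ hδ
    obtain ⟨x, hx, x', hx', rfl⟩ := hmemD.1 hδ
    exact exists_eq_mul_inv_of_difL_pos (by have := hNPY x hx x' hx'; omega)
  have hDσ : ∀ δ ∈ D, σ ≤ difR X δ := by
    intro δ hδ
    obtain ⟨y, hy, y', hy', rfl⟩ := hDYY δ hδ
    exact hNPX y' hy' y hy
  have hDσ' : ∀ δ ∈ D, σ' ≤ difL Y δ := by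
    intro δ hδ
    obtain ⟨x, hx, x', hx', rfl⟩ := hmemD.1 hδ
    exact hNPY x hx x' hx'
  have hDinv : ∀ δ ∈ D, δ⁻¹ ∈ D := by
    intro δ hδ
    obtain ⟨x, hx, x', hx', rfl⟩ := hmemD.1 hδ
    exact hmemD.2 ⟨x', hx', x, hx, by group⟩
  -- closure
  have hDmul : ∀ δ₁ ∈ D, ∀ δ₂ ∈ D, δ₁ * δ₂ ∈ D := by
    intro δ₁ h₁ δ₂ h₂
    rcases hbig with hb | hb
    · have hpos := difR_mul_pos_of_lt hX (δ₁ := δ₁) (δ₂ := δ₂)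
        (by have := hDσ δ₁ h₁; omega) (by have := hDσ δ₂⁻¹ (hDinv δ₂ h₂); omega)
      obtain ⟨x, hx, x', hx', he⟩ := exists_eq_inv_mul_of_difR_pos hpos
      exact hmemD.2 ⟨x', hx', x, hx, he⟩
    · have hpos := difL_mul_pos_of_lt hY (g₁ := δ₂) (g₂ := δ₁)
        (by have := hDσ' δ₂ h₂; omega) (by have := hDσ' δ₁ h₁; omega)
      obtain ⟨y, hy, y', hy', he⟩ := exists_eq_mul_inv_of_difL_pos hpos
      rw [he]
      exact hYYD y' hy' y hy
  obtain ⟨x₀, hx₀⟩ := hXne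
  obtain ⟨y₀, hy₀⟩ := hYne
  have h1D : (1 : G) ∈ D := hmemD.2 ⟨x₀, hx₀, x₀, hx₀, by group⟩
  -- `D` is a subgroup, so `#D ∣ n`
  let K : Subgroup G :=
    { carrier := ↑D
      mul_mem' := fun {u v} hu hv => hDmul u hu v hv
      one_mem' := h1D
      inv_mem' := fun {u} hu => hDinv u hu }
  have hKcard : Nat.card K = #D := by
    rw [← Nat.card_eq_finsetCard]
    rfl
  have hdvd : #D ∣ n := by
    have := Subgroup.card_subgroup_dvd_card K
    rwa [hKcard, Nat.card_eq_fintype_card, hn] at this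
  -- (i) sizes at most `e = #D`
  have hXe : sX ≤ #D := by
    rw [← hX, ← card_image_of_injective X (mul_right_injective x₀⁻¹)]
    exact card_le_card fun d hd => by
      obtain ⟨x, hx, rfl⟩ := mem_image.1 hd
      exact hmemD.2 ⟨x₀, hx₀, x, hx, rfl⟩
  have hYe : sY ≤ #D := by
    rw [← hY, ← card_image_of_injective Y (mul_left_injective y₀⁻¹)]
    exact card_le_card fun d hd => by
      obtain ⟨y, hy, rfl⟩ := mem_image.1 hd
      exact hYYD y₀ hy₀ y hy
  set P := D.image (fun d => x₀ * d * y₀) with hPdef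
  have hPD : #P = #D :=
    card_image_of_injective _ fun d d' (e : x₀ * d * y₀ = x₀ * d' * y₀) => by simpa using e
  have hXYP : ∀ x ∈ X, ∀ y ∈ Y, x * y ∈ P := by
    intro x hx y hy
    have h1 : x₀⁻¹ * x ∈ D := hmemD.2 ⟨x₀, hx₀, x, hx, rfl⟩
    have h2 : y * y₀⁻¹ ∈ D := hYYD y₀ hy₀ y hy
    refine mem_image.2 ⟨x₀⁻¹ * x * (y * y₀⁻¹), hDmul _ h1 _ h2, by group⟩
  have hZP : Z ⊆ P := fun z hz => by
    obtain ⟨x, hx, y, hy, rfl⟩ := exists_eq_mul_of_repMul_pos (hZpos z hz)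
    exact hXYP x hx y hy
  have hZe : sZ ≤ #D := by rw [← hZ, ← hPD]; exact card_le_card hZP
  -- (ii) mass, (iii) energies
  have hmass := card_mul_card_le_of_subset_mul hXYP hZP hV
  rw [hX, hY, hZ, hPD] at hmass
  have hEX := card_sub_one_mul_le_of_difR (S := X) h1D hDσ
  have hEY := card_sub_one_mul_le_of_difL (S := Y) h1D hDσ'
  rw [hX] at hEX
  rw [hY] at hEY
  -- the divisor `e = #D` refutes `hall`
  have hDle : #D < n + 1 := by
    have := card_le_univ D
    rw [hn] at this
    omega
  have hDpos : 0 < #D := card_pos.2 ⟨1, h1D⟩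
  have hadm : n12Adm sX sY sZ σ σ' #D = true := by
    simp only [n12Adm, Bool.and_eq_true, decide_eq_true_eq]
    exact ⟨⟨⟨⟨hXe, hYe⟩, hZe⟩, hEX⟩, hEY⟩
  have := hall #D hDle hdvd hDpos hadm
  omega

end Abstract

end Summit.MatrixMultiplication.OmegaCensus.CubeNB
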